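import Summits.QuantumAdvantage.QuantumAdvantage.Theorems.SteerDialItems
import Summits.QuantumAdvantage.QuantumAdvantage.Theorems.SpreadBridge
import Literature.Computability.MetaComplexity.RazborovSmolenskyApprox
import Literature.Computability.MetaComplexity.LowDegreeComposition
import HarnessLib

/-!
# CodimDial — part 1/6 «Basic» (cell decomp-qadv, seat lens-5, generation 12 rev 2; supports item 30910 `SpreadDial.PureCover3`)

§1 vocabulary (`bit`, `defect`, `linEvent`, `lossSet`, `rowWeight`), §2 the statements of the dial (`LinSpread3`, `LinSpreadLog3`, `LinSpreadLight3`, `LinSpreadOne3`, cover forms `LinCoverLog3` / `LinCoverLight3` / `LinCoverOne3`), §3 Razborov's random 𝔽₂-combination applied to the ADVERSARY's constraints (`exists_reduction`, `defect_combine`, `collapse_exponent`), §4 ★ THE COLLAPSE `linSpread3_iff_linSpreadLog3` (arbitrary codimension ⟺ logarithmic codimension `2^ℓ ≤ n^C`, loss exponent +1).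

Verbatim from the node file `run/shared/lean/pub/decomp-qadv/decomp-qadv-lens-5/g12/CodimDial.lean` (rev 2, sha256 b503e7e59b532c38…;
record `…/g12/NODE-g12.md`; critic row 74 VERIFIED/CLEARED the split), re-namespaced `…Theses.CodimDial` ↦ `…Theorems.CodimDial`;
imports the node imports; joint check of parts 1–1 = `g12/tree/Parts1to1.check.lean` (farm rc 0 · 0 errors ·
0 warnings · 0 sorries).  The `def … : Prop` declarations are STATEMENTS OF THE NODE (regimes of the dial and the two pieces of the exact split
`PureCover3 ⟺ A ∧ B`), not new cruxes; the pieces to FILE are `FewCover3` / `FewBridge3` (part 6) or equivalently `LinCoverLogMed3` / `MedBridge3` (part 5).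
NODE EQUATION: `AdviceFreeQNC0Three ⟸ PolyLoss3 [26123] ∧ AlgCover3 [30909] ∧ A ∧ B`, `PureCover3 (30910) ⟺ A ∧ B` (kernel).
-/

set_option linter.style.longLine false
set_option linter.dupNamespace false

noncomputable section
open scoped Classical

namespace Summit.QuantumAdvantage.QuantumAdvantage.Theorems.CodimDial

open Finset
open Literature.Computability.QuantumComplexity Literature.Computability.QuantumComplexity.RingHLF
open Literature.Computability.MetaComplexity
open Summit.QuantumAdvantage.AdviceFreeQNC0
open Summit.QuantumAdvantage.QuantumAdvantage.Theses

/-! ## §1  Vocabulary: 𝔽₂-bits of 𝔽₃ answer functions, affine 𝔽₂-systems on them, their events -/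

section Vocabulary
variable {n : ℕ}

/-- the Boolean read-out `[G y = 1]` of an `𝔽₃`-valued answer function, as an element of `𝔽₂`. -/
def bit (G : Smolensky.CubeFn (ZMod 3) n) (y : Fin n → Bool) : ZMod 2 := if G y = 1 then 1 else 0

/-- the DEFECT at `y` of the affine `𝔽₂`-constraint with coefficient row `a` and right-hand side `β` on the bits
of the answer family `G`: `Σ_u a_u·[G_u y = 1] + β` — the constraint HOLDS at `y` iff its defect is `0`. -/
def defect {N : ℕ} (G : Fin N → Smolensky.CubeFn (ZMod 3) n) (a : Fin N → ZMod 2) (β : ZMod 2)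
    (y : Fin n → Bool) : ZMod 2 :=
  (∑ u, a u * bit (G u) y) + β

/-- the EVENT cut out by the affine `𝔽₂`-system `(A, b)` with `ℓ` rows (codimension `≤ ℓ`) on the bits of `G`. -/
def linEvent {N ℓ : ℕ} (G : Fin N → Smolensky.CubeFn (ZMod 3) n) (A : Fin ℓ → Fin N → ZMod 2)
    (b : Fin ℓ → ZMod 2) : Finset (Fin n → Bool) :=
  univ.filter fun y => ∀ r, defect G (A r) (b r) y = 0

/-- the LOSS set of the victim strategy `P` (inputs on which `z_i = [P_i y = 1]` violates the ring relation). -/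
def lossSet (P : Fin n → Smolensky.CubeFn (ZMod 3) n) : Finset (Fin n → Bool) :=
  univ.filter fun y => ¬ RingHLF.Rel y (fun i => decide (P i y = 1))

/-- the WEIGHT of a coefficient row. -/
def rowWeight {N : ℕ} (a : Fin N → ZMod 2) : ℕ := (univ.filter fun u => a u ≠ 0).card

end Vocabulary

/-! ## §2  The statements of the dial (codimension `ℓ`: arbitrary · `2^ℓ ≤ n^C` · light rows · one row) -/

/-- **LinSpread3** (abstract foreign spread, ARBITRARY codimension): some `η > 0` and `k` such that for all
exponents `C, c`, all large `n`, every victim `P` of degree `≤ (log₂ n)^c`, every family of `N ≤ n^C` answer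
functions `G_u` of degree `≤ (log₂ n)^c` and EVERY affine `𝔽₂`-system `(A, b)` on the bits `[G_u = 1]` whose event
`E` has `#E ≥ (1-η)·2ⁿ`: at least `2ⁿ/n^k` points of `E` are losses of `P`. -/
def LinSpread3 : Prop :=
  ∃ η : ℝ, 0 < η ∧ ∃ k : ℕ, ∀ C c : ℕ, ∃ n₀ : ℕ, ∀ n ≥ n₀,
    ∀ P : Fin n → Smolensky.CubeFn (ZMod 3) n, (∀ i, P i ∈ Smolensky.lowDeg (ZMod 3) n ((Nat.log 2 n) ^ c)) →
    ∀ N ≤ n ^ C, ∀ G : Fin N → Smolensky.CubeFn (ZMod 3) n,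
      (∀ u, G u ∈ Smolensky.lowDeg (ZMod 3) n ((Nat.log 2 n) ^ c)) →
    ∀ ℓ : ℕ, ∀ A : Fin ℓ → Fin N → ZMod 2, ∀ b : Fin ℓ → ZMod 2,
      (1 - η) * (2 : ℝ) ^ n ≤ ((linEvent G A b).card : ℝ) →
      1 / (n : ℝ) ^ k * (2 : ℝ) ^ n ≤ ((linEvent G A b ∩ lossSet P).card : ℝ)

/-- **LinSpreadLog3** (FINITE RANGE of the dial: LOGARITHMIC codimension, `2^ℓ ≤ n^C`): the same, asked only of
systems with `2^ℓ ≤ n^C` rows-worth of codimension. -/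
def LinSpreadLog3 : Prop :=
  ∃ η : ℝ, 0 < η ∧ ∃ k : ℕ, ∀ C c : ℕ, ∃ n₀ : ℕ, ∀ n ≥ n₀,
    ∀ P : Fin n → Smolensky.CubeFn (ZMod 3) n, (∀ i, P i ∈ Smolensky.lowDeg (ZMod 3) n ((Nat.log 2 n) ^ c)) →
    ∀ N ≤ n ^ C, ∀ G : Fin N → Smolensky.CubeFn (ZMod 3) n,
      (∀ u, G u ∈ Smolensky.lowDeg (ZMod 3) n ((Nat.log 2 n) ^ c)) →
    ∀ ℓ : ℕ, 2 ^ ℓ ≤ n ^ C → ∀ A : Fin ℓ → Fin N → ZMod 2, ∀ b : Fin ℓ → ZMod 2,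
      (1 - η) * (2 : ℝ) ^ n ≤ ((linEvent G A b).card : ℝ) →
      1 / (n : ℝ) ^ k * (2 : ℝ) ^ n ≤ ((linEvent G A b ∩ lossSet P).card : ℝ)

/-- **LinSpreadLight3** (BASE of the dial, PROVED from `AlgSpread3`): logarithmic codimension AND every row of
weight `≤ (log₂ n)^c` (a parity of polylog many bits). -/
def LinSpreadLight3 : Prop :=
  ∃ η : ℝ, 0 < η ∧ ∃ k : ℕ, ∀ C c : ℕ, ∃ n₀ : ℕ, ∀ n ≥ n₀,
    ∀ P : Fin n → Smolensky.CubeFn (ZMod 3) n, (∀ i, P i ∈ Smolensky.lowDeg (ZMod 3) n ((Nat.log 2 n) ^ c)) →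
    ∀ N ≤ n ^ C, ∀ G : Fin N → Smolensky.CubeFn (ZMod 3) n,
      (∀ u, G u ∈ Smolensky.lowDeg (ZMod 3) n ((Nat.log 2 n) ^ c)) →
    ∀ ℓ : ℕ, 2 ^ ℓ ≤ n ^ C → ∀ A : Fin ℓ → Fin N → ZMod 2, ∀ b : Fin ℓ → ZMod 2,
      (∀ r, rowWeight (A r) ≤ (Nat.log 2 n) ^ c) →
      (1 - η) * (2 : ℝ) ^ n ≤ ((linEvent G A b).card : ℝ) →
      1 / (n : ℝ) ^ k * (2 : ℝ) ^ n ≤ ((linEvent G A b ∩ lossSet P).card : ℝ)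

/-- **LinSpreadOne3** (codimension ONE: a single affine parity constraint of arbitrary weight). -/
def LinSpreadOne3 : Prop :=
  ∃ η : ℝ, 0 < η ∧ ∃ k : ℕ, ∀ C c : ℕ, ∃ n₀ : ℕ, ∀ n ≥ n₀,
    ∀ P : Fin n → Smolensky.CubeFn (ZMod 3) n, (∀ i, P i ∈ Smolensky.lowDeg (ZMod 3) n ((Nat.log 2 n) ^ c)) →
    ∀ N ≤ n ^ C, ∀ G : Fin N → Smolensky.CubeFn (ZMod 3) n,
      (∀ u, G u ∈ Smolensky.lowDeg (ZMod 3) n ((Nat.log 2 n) ^ c)) →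
    ∀ ℓ ≤ 1, ∀ A : Fin ℓ → Fin N → ZMod 2, ∀ b : Fin ℓ → ZMod 2,
      (1 - η) * (2 : ℝ) ^ n ≤ ((linEvent G A b).card : ℝ) →
      1 / (n : ℝ) ^ k * (2 : ℝ) ^ n ≤ ((linEvent G A b ∩ lossSet P).card : ℝ)

/-- **LinCoverLog3** [aside · TOP of the dial · UNDECIDED · `⟹ PureCover3` (30910) PROVED, converse unknown (rings of
length `n` cannot host rows of weight `> n/2`) · necessary for T]: granted poly loss and algebraic spread, foreign spread
holds against affine 𝔽₂-systems of LOGARITHMIC codimension and ARBITRARY row weight. -/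
def LinCoverLog3 : Prop := SpreadDial.PolyLoss3 → SpreadDial.AlgSpread3 → LinSpreadLog3

/-- **LinCoverLight3** — the base rung in cover form (PROVED outright: `linCoverLight3`). -/
def LinCoverLight3 : Prop := SpreadDial.PolyLoss3 → SpreadDial.AlgSpread3 → LinSpreadLight3

/-- **LinCoverOne3** — the codimension-one rung in cover form (first instance beyond the base: TameDial's
parity-product ring `NandSpread3` is a codimension-one heavy row). -/
def LinCoverOne3 : Prop := SpreadDial.PolyLoss3 → SpreadDial.AlgSpread3 → LinSpreadOne3

/-! ## §3  Razborov's random 𝔽₂-combination, applied to the ADVERSARY's constraints: codimension reduction -/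

section Reduction

/-- half of all coefficient vectors are orthogonal to a fixed non-zero defect vector. -/
theorem card_orth_mul_two {M : ℕ} (δ : Fin M → ZMod 2) (j₀ : Fin M) (hj₀ : δ j₀ ≠ 0) :
    (univ.filter fun ρ : Fin M → ZMod 2 => (∑ j, ρ j * δ j) = 0).card * 2 = 2 ^ M := by
  have h := Smolensky.card_filter_linear_eq_zero_mul (p := 2) (A := M) (k := M) id Function.injective_id δ j₀ hj₀
  simpa using h

/-- **Codimension reduction** (double counting): for any defect table `d : X → 𝔽₂^M` and any `ℓ` there are `ℓ`
random-looking combinations `R` such that the points where all `ℓ` combined defects vanish but some original defect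
does not number at most `#X / 2^ℓ`. -/
theorem exists_reduction {X : Type*} [Fintype X] {M : ℕ} (d : X → Fin M → ZMod 2) (ℓ : ℕ) :
    ∃ R : Fin ℓ → Fin M → ZMod 2,
      (univ.filter fun x : X => (∀ r, (∑ j, R r j * d x j) = 0) ∧ ¬ ∀ j, d x j = 0).card * 2 ^ ℓ
        ≤ Fintype.card X := by
  let Bad : (Fin ℓ → Fin M → ZMod 2) → Finset X := fun R =>
    univ.filter fun x => (∀ r, (∑ j, R r j * d x j) = 0) ∧ ¬ ∀ j, d x j = 0
  let Y₀ : Finset X := univ.filter fun x => ¬ ∀ j, d x j = 0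
  let Gd : X → Finset (Fin ℓ → Fin M → ZMod 2) := fun x =>
    univ.filter fun R => ∀ r, (∑ j, R r j * d x j) = 0
  -- for `x ∈ Y₀` the good tables are a `2^{-ℓ}` fraction
  have hG : ∀ x ∈ Y₀, (Gd x).card * 2 ^ ℓ = Fintype.card (Fin ℓ → Fin M → ZMod 2) := by
    intro x hx
    simp only [Y₀, mem_filter, mem_univ, true_and, not_forall] at hx
    obtain ⟨j₀, hj₀⟩ := hx
    let Z : Finset (Fin M → ZMod 2) := univ.filter fun ρ => (∑ j, ρ j * d x j) = 0
    have hZ : Z.card * 2 = 2 ^ M := card_orth_mul_two (d x) j₀ hj₀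
    have hGZ : (Gd x).card = Z.card ^ ℓ := by
      rw [← Smolensky.card_filter_forall_mem (β := Fin M → ZMod 2) Z ℓ]
      congr 1
      ext R
      simp [Gd, Z]
    rw [hGZ, ← mul_pow, hZ, Fintype.card_fun, Fintype.card_fin, Fintype.card_fun, Fintype.card_fin, ZMod.card,
      ← pow_mul, mul_comm M ℓ]
  -- double counting: Σ_R #Bad R = Σ_{x ∈ Y₀} #Gd x
  have hdc : ∑ R : Fin ℓ → Fin M → ZMod 2, (Bad R).card = ∑ x ∈ Y₀, (Gd x).card := by
    have h1 : ∀ R : Fin ℓ → Fin M → ZMod 2, (Bad R).card = ∑ x ∈ Y₀, if R ∈ Gd x then 1 else 0 := by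
      intro R
      rw [Finset.card_eq_sum_ones, Finset.sum_filter, Finset.sum_filter]
      refine Finset.sum_congr rfl fun x _ => ?_
      by_cases hx : ∀ j, d x j = 0
      · simp [hx]
      · simp only [hx, not_false_eq_true, and_true, if_true]
        have : (∀ r, (∑ j, R r j * d x j) = 0) ↔ R ∈ Gd x := by simp [Gd]
        by_cases hR : R ∈ Gd x
        · rw [if_pos (this.mpr hR), if_pos hR]
        · rw [if_neg (fun h => hR (this.mp h)), if_neg hR]
    rw [Finset.sum_congr rfl fun R _ => h1 R, Finset.sum_comm]
    refine Finset.sum_congr rfl fun x _ => ?_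
    rw [Finset.card_eq_sum_ones, Finset.sum_filter]
    simp [Gd]
  have hsum : (∑ R : Fin ℓ → Fin M → ZMod 2, (Bad R).card * 2 ^ ℓ)
      ≤ ∑ R : Fin ℓ → Fin M → ZMod 2, Fintype.card X := by
    rw [← Finset.sum_mul, hdc, Finset.sum_mul, Finset.sum_congr rfl fun x hx => hG x hx, Finset.sum_const,
      smul_eq_mul, Finset.sum_const, smul_eq_mul, Finset.card_univ]
    rw [mul_comm]
    refine Nat.mul_le_mul_left _ ?_
    calc Y₀.card ≤ (univ : Finset X).card := Finset.card_le_univ _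
      _ = Fintype.card X := Finset.card_univ
  obtain ⟨R, _, hR⟩ := Finset.exists_le_of_sum_le (univ_nonempty (α := Fin ℓ → Fin M → ZMod 2)) hsum
  exact ⟨R, hR⟩

/-- exponent bookkeeping of the collapse: with `L = log₂ n`, `ℓ = k(L+1)+1` and `n ≥ 2`:
`2·n^k ≤ 2^ℓ` and `2^ℓ ≤ n^(2k+1)`. [arithmetic] -/
theorem collapse_exponent {n k : ℕ} (hn : 2 ≤ n) :
    2 * n ^ k ≤ 2 ^ (k * (Nat.log 2 n + 1) + 1) ∧ 2 ^ (k * (Nat.log 2 n + 1) + 1) ≤ n ^ (2 * k + 1) := by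
  set L := Nat.log 2 n with hL
  have h1 : n < 2 ^ (L + 1) := Nat.lt_pow_succ_log_self (by norm_num) n
  have h2 : 2 ^ L ≤ n := Nat.pow_log_le_self 2 (by omega)
  constructor
  · calc 2 * n ^ k ≤ 2 * (2 ^ (L + 1)) ^ k := Nat.mul_le_mul_left 2 (Nat.pow_le_pow_left h1.le k)
      _ = 2 ^ (k * (L + 1) + 1) := by rw [← pow_mul, pow_succ, mul_comm (L + 1) k, mul_comm]
  · have h3 : (2 : ℕ) ^ (k + 1) ≤ n ^ (k + 1) := Nat.pow_le_pow_left hn _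
    calc 2 ^ (k * (L + 1) + 1) = 2 ^ (k + 1) * (2 ^ L) ^ k := by ring
      _ ≤ n ^ (k + 1) * n ^ k := Nat.mul_le_mul h3 (Nat.pow_le_pow_left h2 k)
      _ = n ^ (2 * k + 1) := by ring

end Reduction

/-! ## §4  THE COLLAPSE (bridge of the dial, PROVED): logarithmic codimension suffices -/

section Collapse
variable {n : ℕ}

/-- combining rows: the defect of a combined row is the combination of the defects. -/
theorem defect_combine {N M ℓ : ℕ} (G : Fin N → Smolensky.CubeFn (ZMod 3) n) (A : Fin M → Fin N → ZMod 2)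
    (b : Fin M → ZMod 2) (R : Fin ℓ → Fin M → ZMod 2) (r : Fin ℓ) (y : Fin n → Bool) :
    defect G (fun u => ∑ j, R r j * A j u) (∑ j, R r j * b j) y = ∑ j, R r j * defect G (A j) (b j) y := by
  simp only [defect, Finset.sum_mul, mul_add, Finset.sum_add_distrib, Finset.mul_sum, mul_assoc]
  congr 1
  exact Finset.sum_comm

/-- **THE COLLAPSE THEOREM**: `LinSpreadLog3 → LinSpread3`.  Given a system `(A, b)` of any codimension with dense
event `E`, pick `ℓ = k(log₂ n+1)+1` combinations `R` by `exists_reduction`; the combined system `(RA, Rb)` has event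
`E' ⊇ E` with `#(E' \ E) ≤ 2ⁿ/2^ℓ ≤ 2ⁿ/(2n^k)` and codimension `ℓ` with `2^ℓ ≤ n^(2k+1)`; the logarithmic statement
gives `2ⁿ/n^k` losses in `E'`, whence `≥ 2ⁿ/(2n^k) ≥ 2ⁿ/n^(k+1)` losses in `E`. -/
theorem linSpread3_of_linSpreadLog3 (h : LinSpreadLog3) : LinSpread3 := by
  obtain ⟨η, hη, k, hk⟩ := h
  refine ⟨η, hη, k + 1, fun C c => ?_⟩
  obtain ⟨n₀, hn₀⟩ := hk (C + 2 * k + 1) c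
  refine ⟨max n₀ 2, fun n hn P hP N hN G hG M A b hdense => ?_⟩
  have hnn₀ : n₀ ≤ n := le_of_max_le_left hn
  have hn2 : 2 ≤ n := le_of_max_le_right hn
  obtain ⟨h2ℓ, hℓC⟩ := collapse_exponent (k := k) hn2
  set ℓ := k * (Nat.log 2 n + 1) + 1 with hℓ
  obtain ⟨R, hR⟩ := exists_reduction (X := Fin n → Bool) (fun y j => defect G (A j) (b j) y) ℓ
  -- the combined system
  let A' : Fin ℓ → Fin N → ZMod 2 := fun r u => ∑ j, R r j * A j u
  let b' : Fin ℓ → ZMod 2 := fun r => ∑ j, R r j * b j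
  have hdef : ∀ r y, defect G (A' r) (b' r) y = ∑ j, R r j * defect G (A j) (b j) y :=
    fun r y => defect_combine G A b R r y
  have hsub : linEvent G A b ⊆ linEvent G A' b' := by
    intro y hy
    simp only [linEvent, mem_filter, mem_univ, true_and] at hy ⊢
    intro r
    rw [hdef]
    exact Finset.sum_eq_zero fun j _ => by rw [hy j, mul_zero]
  have hdense' : (1 - η) * (2 : ℝ) ^ n ≤ ((linEvent G A' b').card : ℝ) :=
    le_trans hdense (by exact_mod_cast card_le_card hsub)
  have hNC : N ≤ n ^ (C + 2 * k + 1) := le_trans hN (Nat.pow_le_pow_right (by omega) (by omega))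
  have hℓC' : 2 ^ ℓ ≤ n ^ (C + 2 * k + 1) := le_trans hℓC (Nat.pow_le_pow_right (by omega) (by omega))
  have hmain := hn₀ n hnn₀ P hP N hNC G hG ℓ hℓC' A' b' hdense'
  -- the leak
  let Bad : Finset (Fin n → Bool) :=
    univ.filter fun y => (∀ r, (∑ j, R r j * defect G (A j) (b j) y) = 0) ∧ ¬ ∀ j, defect G (A j) (b j) y = 0
  have hBad : Bad.card * 2 ^ ℓ ≤ 2 ^ n := by
    have := hR
    simpa [Bad, Fintype.card_fun, Fintype.card_bool, Fintype.card_fin] using this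
  have hcover : linEvent G A' b' ∩ lossSet P ⊆ (linEvent G A b ∩ lossSet P) ∪ Bad := by
    intro y hy
    rw [Finset.mem_inter] at hy
    obtain ⟨hyE', hyL⟩ := hy
    by_cases hyE : y ∈ linEvent G A b
    · exact Finset.mem_union_left _ (Finset.mem_inter.mpr ⟨hyE, hyL⟩)
    · refine Finset.mem_union_right _ ?_
      simp only [linEvent, mem_filter, mem_univ, true_and] at hyE' hyE
      simp only [Bad, mem_filter, mem_univ, true_and]
      exact ⟨fun r => by rw [← hdef]; exact hyE' r, hyE⟩
  have hcard : (linEvent G A' b' ∩ lossSet P).card ≤ (linEvent G A b ∩ lossSet P).card + Bad.card :=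
    le_trans (card_le_card hcover) (Finset.card_union_le _ _)
  -- arithmetic in ℝ
  set a : ℝ := ((linEvent G A b ∩ lossSet P).card : ℝ) with ha
  have ha0 : 0 ≤ a := by positivity
  have hnk : (0 : ℝ) < (n : ℝ) ^ k := by positivity
  have hX : (0 : ℝ) < (2 : ℝ) ^ n := by positivity
  have hcardR : ((linEvent G A' b' ∩ lossSet P).card : ℝ) ≤ a + (Bad.card : ℝ) := by
    rw [ha]; exact_mod_cast hcard
  have hBadR : (Bad.card : ℝ) * (2 : ℝ) ^ ℓ ≤ (2 : ℝ) ^ n := by exact_mod_cast hBad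
  have h2ℓR : 2 * (n : ℝ) ^ k ≤ (2 : ℝ) ^ ℓ := by exact_mod_cast h2ℓ
  have hB2 : 2 * ((Bad.card : ℝ) * (n : ℝ) ^ k) ≤ (2 : ℝ) ^ n := by
    calc 2 * ((Bad.card : ℝ) * (n : ℝ) ^ k) = (Bad.card : ℝ) * (2 * (n : ℝ) ^ k) := by ring
      _ ≤ (Bad.card : ℝ) * (2 : ℝ) ^ ℓ := mul_le_mul_of_nonneg_left h2ℓR (by positivity)
      _ ≤ (2 : ℝ) ^ n := hBadR
  have hmain' : (2 : ℝ) ^ n ≤ a * (n : ℝ) ^ k + (Bad.card : ℝ) * (n : ℝ) ^ k := by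
    have e1 : 1 / (n : ℝ) ^ k * (2 : ℝ) ^ n = (2 : ℝ) ^ n / (n : ℝ) ^ k := by ring
    rw [e1, div_le_iff₀ hnk] at hmain
    nlinarith [hmain, hcardR, hnk.le]
  have hfinal : (2 : ℝ) ^ n ≤ a * (n : ℝ) ^ (k + 1) := by
    have hn2R : (2 : ℝ) ≤ n := by exact_mod_cast hn2
    calc (2 : ℝ) ^ n ≤ 2 * (a * (n : ℝ) ^ k) := by linarith
      _ ≤ (n : ℝ) * (a * (n : ℝ) ^ k) := mul_le_mul_of_nonneg_right hn2R (by positivity)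
      _ = a * (n : ℝ) ^ (k + 1) := by ring
  calc 1 / (n : ℝ) ^ (k + 1) * (2 : ℝ) ^ n = (2 : ℝ) ^ n / (n : ℝ) ^ (k + 1) := by ring
    _ ≤ a := by rw [div_le_iff₀ (by positivity)]; exact hfinal

/-- the other direction is a restriction: `LinSpread3 → LinSpreadLog3`. -/
theorem linSpreadLog3_of_linSpread3 (h : LinSpread3) : LinSpreadLog3 := by
  obtain ⟨η, hη, k, hk⟩ := h
  refine ⟨η, hη, k, fun C c => ?_⟩
  obtain ⟨n₀, hn₀⟩ := hk C c
  exact ⟨n₀, fun n hn P hP N hN G hG ℓ _ A b hd => hn₀ n hn P hP N hN G hG ℓ A b hd⟩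

/-- **NORMAL FORM**: arbitrary codimension ⟺ logarithmic codimension. -/
theorem linSpread3_iff_linSpreadLog3 : LinSpread3 ↔ LinSpreadLog3 :=
  ⟨linSpreadLog3_of_linSpread3, linSpread3_of_linSpreadLog3⟩

/-- restrictions down the dial. -/
theorem linSpreadLight3_of_linSpreadLog3 (h : LinSpreadLog3) : LinSpreadLight3 := by
  obtain ⟨η, hη, k, hk⟩ := h
  refine ⟨η, hη, k, fun C c => ?_⟩
  obtain ⟨n₀, hn₀⟩ := hk C c
  exact ⟨n₀, fun n hn P hP N hN G hG ℓ hℓ A b _ hd => hn₀ n hn P hP N hN G hG ℓ hℓ A b hd⟩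

/-- CodimDialBasic helper `linSpreadOne3_of_linSpread3` (decomp-qadv land package; see the module docstring). -/
theorem linSpreadOne3_of_linSpread3 (h : LinSpread3) : LinSpreadOne3 := by
  obtain ⟨η, hη, k, hk⟩ := h
  refine ⟨η, hη, k, fun C c => ?_⟩
  obtain ⟨n₀, hn₀⟩ := hk C c
  exact ⟨n₀, fun n hn P hP N hN G hG ℓ _ A b hd => hn₀ n hn P hP N hN G hG ℓ A b hd⟩

/-- CodimDialBasic helper `linSpreadOne3_of_linSpreadLog3` (decomp-qadv land package; see the module docstring). -/
theorem linSpreadOne3_of_linSpreadLog3 (h : LinSpreadLog3) : LinSpreadOne3 :=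
  linSpreadOne3_of_linSpread3 (linSpread3_of_linSpreadLog3 h)

end Collapse

end Summit.QuantumAdvantage.QuantumAdvantage.Theorems.CodimDial
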